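import Mathlib
import HarnessLib
import Literature.Combinatorics.Additive.KempermanElementaryPairs

/-!
# Critical pairs whose sum is the group with one element deleted are Kemperman pairs

[cite: Kemperman1960, Lemma 5.2; Lemma 4.6] [tag: critical-pair] [tag: inverse-theorem]

Topic `Literature/Combinatorics/Additive`.  Cell `mm-stpp` (D-0046), seat `mm-stpp-lit` (gen 22); the
bottom case of the «only if» half of the Kemperman Structure Theorem along the
Boothby–DeVos–Montejano chain (memo `KST-BRIDGE-PLAN.md` §4 of the cell): a pure beat `({0}, B, C)`
of deficiency `1` presents the pair `(B, C)` with `B + C = G ∖ {0}`, `|B| + |C| = |G|`.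

SOURCE.  J. H. B. Kemperman, *On small sumsets in an abelian group*, Acta Math. **103** (1960)
63–88: Lemma 4.2 (p. 72, the tree's `kemperman_lemma42`), Lemma 4.6 (p. 77 of the held text
`paper:doi-10-1007-bf02546525`, p0015 L36–L41: «Let `A`, `B` be finite non-empty subsets of `G`
satisfying (3) and `ν_{c₀}(A, B) = 1` for some `c₀ ∈ A + B`.  Let `K` denote a finite subgroup of
`G` and suppose that either (i) … or (ii) `A + B` is obtained from `c₀ + K` by deleting one element
`c₁`.  Then either both `A` and `B` are in arithmetic progression of difference `d = c₁ − c₀` or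
`P₁(A, B)` is non-empty.») and the proof of Lemma 5.2, case (ii) (p. 79: «If `ν_c(A, B) ≥ 2` for
each `c ∈ A + B` then … `(A, B)` is an elementary pair of type (IV) … If `ν_c(A, B) = 1` for some
element `c` … either `(A, B)` is an elementary pair of type II … or `P₁(A, B)` is non-void»), which
with Lemma 5.1 (recursion on `P₁`) yields conditions (i)–(iv) of Theorem 5.1.

MAIN RESULT.  `exists_isKempermanDecompI_of_add_eq_univ_erase`: `A, B ≠ ∅`, `A + B = G ∖ {c₀}`,
`|A + B| ≤ |A| + |B| − 1` ⟹ `∃ H A₁ A₀ B₁ B₀, IsKempermanDecompI H A B A₁ A₀ B₁ B₀` (Kemperman's form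
(i)–(iv); Grynkiewicz's 2009 condition (iii) is not asserted).  0 named facts; everything PROVED.

PROOF (ours; Kemperman's `P(A, B)` machinery of Lemmas 4.4–4.6 is replaced by the tree's
quasi-progressions of Grynkiewicz 2009 §2).  By Lemma 4.2, `B = c₀ − Ā`.  If no element of `A + B`
has a unique expression, `(A, B)` is of type (IV) (`isElementaryIV_of_add_eq_erase`) and
`IsElementaryPair.isKempermanDecompI_top` applies.  If `c` has a unique expression, then with
`k = c₀ − c ≠ 0`: `1 = r_{A,B}(c) = #{a ∈ A : a + k ∉ A} = c_k(A)` (`addConvolution_eq_componentCount`),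
i.e. `A` is a quasi-progression with difference `k`; by `IsQuasiProgression.exists_isQuasiPeriodicDecomp`
`A = A₁ ⊔ A₀` with `A₁` `⟨k⟩`-periodic and `A₀ ≠ ∅` a progression with difference `k` inside one coset
`C₀ = a₀ + ⟨k⟩`, `A₀ ≠ C₀` (else `A` would be `k`-invariant).  Put `B₀ = c₀ − (C₀ ∖ A₀)` and
`B₁ = c₀ − \overline{A₁ ∪ C₀}`: `B = B₁ ⊔ B₀` is a quasi-periodic decomposition with quasi-period `⟨k⟩`
(`decomp_B`); (i) a sum `a + b ≡ a₀' + b₀' (mod ⟨k⟩)` forces `a ∈ A₀ + ⟨k⟩` — otherwise `a ∈ A₁` and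
`c₀ − b ≡ a` would lie in `A₁ ⊆ A` (`quot_unique_B`); (ii) `|φ(A + B)| = [G : ⟨k⟩]`,
`|φ(A)| = |φ(A₁)| + 1`, `|φ(B)| = ([G : ⟨k⟩] − |φ(A₁)| − 1) + 1` (`cosetCount_AB`); (iv) `C₀ ∖ A₀` is the
progression `{s + ℓk, …, s + (n − 1)k}` (`coset_sdiff_apFinset_eq`), so `A₀`, `B₀` are progressions
with difference `k` of total size `n = ord k`: type (I) or (II) (`elementary_A₀B₀`).

Also: `image_const_sub_eq_vadd_neg`, `IsPeriodicWith.image_const_sub`, `cosetCount_image_const_sub`,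
`IsKempermanDecompI.vadd`.

## References
* J. H. B. Kemperman, *On small sumsets in an abelian group*, Acta Math. 103 (1960) 63–88,
  doi:10.1007/BF02546525 — Lemma 4.2 p. 72, Lemma 4.6 p. 77, Lemma 5.2 and its proof p. 79
  (held `paper:doi-10-1007-bf02546525`, p0010/p0015/p0017 read 2026-08-29)
  [cite: Kemperman1960, Lemma 5.2].
* D. J. Grynkiewicz, *A step beyond Kemperman's structure theorem*, Mathematika 55 (2009) 67–114, §2
  (quasi-progressions, quasi-periodic decompositions) [cite: Grynkiewicz2009, §2].
* D. J. Grynkiewicz, *Quasi-periodic decompositions and the Kemperman structure theorem*, European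
  J. Combin. 26 (2005) 559–575, §2 («KST I») [cite: Grynkiewicz2005, §2].
-/

namespace Literature.Combinatorics.Additive

open Finset
open scoped Pointwise

variable {G : Type*} [AddCommGroup G] [DecidableEq G]

/-! ### Reflection `x ↦ c₀ − x` -/

/-- `c₀ − X = c₀ + (−X)` as finsets. [cite: Kemperman1960, §4 (Lemma 4.2: `B = c₀ − Ā ∩ (a + H)`)] -/
theorem image_const_sub_eq_vadd_neg (X : Finset G) (c₀ : G) :
    X.image (fun x => c₀ - x) = c₀ +ᵥ (-X) := by
  ext y
  simp only [mem_image, mem_vadd_finset, mem_neg', vadd_eq_add]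
  constructor
  · rintro ⟨x, hx, rfl⟩
    exact ⟨-x, by rw [neg_neg]; exact hx, by rw [sub_eq_add_neg]⟩
  · rintro ⟨z, hz, rfl⟩
    exact ⟨-z, hz, by rw [sub_neg_eq_add]⟩

/-- The reflection of an `H`-periodic set is `H`-periodic. [cite: Kemperman1960, §4] -/
theorem IsPeriodicWith.image_const_sub {H : AddSubgroup G} {X : Finset G} (hX : IsPeriodicWith H X)
    (c₀ : G) : IsPeriodicWith H (X.image fun x => c₀ - x) := by
  rw [image_const_sub_eq_vadd_neg]
  exact hX.neg.vadd c₀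

/-- `|φ_H(c₀ − X)| = |φ_H(X)|`. [cite: Kemperman1960, §4] -/
theorem cosetCount_image_const_sub (H : AddSubgroup G) (X : Finset G) (c₀ : G) :
    cosetCount H (X.image fun x => c₀ - x) = cosetCount H X := by
  rw [image_const_sub_eq_vadd_neg, cosetCount_vadd, cosetCount_neg]

/-! ### The representation count of `(A, c₀ − Ā)` is the run-end count of `A` -/

/-- For `B = c₀ − Ā` (i.e. `y ∈ B ↔ c₀ − y ∉ A`): `r_{A,B}(c) = c_{c₀ − c}(A) = |((c₀ − c) + A) ∖ A|`,
the number of `a ∈ A` with `a + (c₀ − c) ∉ A`. [cite: Kemperman1960, Lemma 4.6 (proof)] -/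
theorem addConvolution_eq_componentCount [Fintype G] {A B : Finset G} {c₀ : G}
    (hB : ∀ y, y ∈ B ↔ c₀ - y ∉ A) (c : G) :
    A.addConvolution B c = componentCount (c₀ - c) A := by
  rw [Grynkiewicz2009.addConvolution_comm, addConvolution_eq_card_filter,
    componentCount_eq_card_vadd_sdiff]
  have hk : ((c₀ - c) +ᵥ A) \ A = (c₀ - c) +ᵥ (A.filter fun a => c - a ∈ B) := by
    ext x
    simp only [mem_sdiff, mem_vadd_finset, mem_filter, vadd_eq_add]
    constructor
    · rintro ⟨⟨a, ha, rfl⟩, hx⟩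
      refine ⟨a, ⟨ha, (hB _).2 ?_⟩, rfl⟩
      have e : c₀ - (c - a) = c₀ - c + a := by abel
      rw [e]; exact hx
    · rintro ⟨a, ⟨ha, hb⟩, rfl⟩
      refine ⟨⟨a, ha, rfl⟩, ?_⟩
      have := (hB _).1 hb
      have e : c₀ - (c - a) = c₀ - c + a := by abel
      rwa [e] at this
  rw [hk, card_vadd_finset]

/-! ### The pair `(A, c₀ − Ā)` when `A` is a quasi-progression: the Kemperman decomposition -/

section QuasiProgression

variable [Fintype G]

/-- The finset of `⟨k⟩`. [cite: Grynkiewicz2009, §2] -/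
private theorem mem_apFinset_zero_addOrderOf_iff (k g : G) :
    g ∈ apFinset (0 : G) k (addOrderOf k) ↔ g ∈ AddSubgroup.zmultiples k := by
  rw [← mem_coe, ← Isoperimetric.coe_zmultiples_eq_coe_apFinset k, SetLike.mem_coe]

omit [Fintype G] in
/-- Inside the coset `s + ⟨k⟩`, the complement of the progression `{s, s + k, …, s + (ℓ−1)k}` is the
progression `{s + ℓk, …, s + (n−1)k}` (`n` the order of `k`). [cite: Kemperman1960, Lemma 4.6] -/
private theorem coset_sdiff_apFinset_eq (s k : G) {ℓ : ℕ} (hℓ : ℓ ≤ addOrderOf k) :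
    (s +ᵥ apFinset (0 : G) k (addOrderOf k)) \ apFinset s k ℓ =
        apFinset (s + ℓ • k) k (addOrderOf k - ℓ) ∧
      #((s +ᵥ apFinset (0 : G) k (addOrderOf k)) \ apFinset s k ℓ) = addOrderOf k - ℓ := by
  have hcos : s +ᵥ apFinset (0 : G) k (addOrderOf k) = apFinset s k (addOrderOf k) := by
    rw [vadd_apFinset, add_zero]
  obtain ⟨m, hm⟩ : ∃ m, addOrderOf k = ℓ + m := ⟨addOrderOf k - ℓ, by omega⟩
  have hsplit : apFinset s k (addOrderOf k) = apFinset s k ℓ ∪ apFinset (s + ℓ • k) k m := by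
    rw [hm, apFinset_add_eq_union]
  have hn : #(apFinset s k (addOrderOf k)) = addOrderOf k :=
    Isoperimetric.card_apFinset_of_le_addOrderOf _ _ le_rfl
  have h1 : #(apFinset s k ℓ) ≤ ℓ := card_apFinset_le _ _ _
  have h2 : #(apFinset (s + ℓ • k) k m) ≤ m := card_apFinset_le _ _ _
  have hdisj : Disjoint (apFinset s k ℓ) (apFinset (s + ℓ • k) k m) := by
    rw [disjoint_iff_inter_eq_empty, ← card_eq_zero]
    have := card_union_add_card_inter (apFinset s k ℓ) (apFinset (s + ℓ • k) k m)
    rw [← hsplit, hn] at this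
    omega
  have heq : (s +ᵥ apFinset (0 : G) k (addOrderOf k)) \ apFinset s k ℓ = apFinset (s + ℓ • k) k m := by
    rw [hcos, hsplit, union_sdiff_left, sdiff_eq_self_of_disjoint hdisj.symm]
  have hmeq : m = addOrderOf k - ℓ := by omega
  refine ⟨by rw [heq, hmeq], ?_⟩
  rw [heq]
  have := card_union_of_disjoint hdisj
  rw [← hsplit, hn] at this
  omega

variable {A B A₁ A₀ : Finset G} {c₀ k a₀ : G}

/-- The data of the construction: `K = ⟨k⟩` as a finset `Kf`, the coset `C₀ = a₀ + K` of `A₀`, the two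
parts `B₀ = c₀ − (C₀ ∖ A₀)` and `B₁ = c₀ − \overline{A₁ ∪ C₀}` of `B = c₀ − Ā`.
Membership in `B₀`. [cite: Kemperman1960, Lemma 4.6; Thm 5.1] -/
private theorem mem_B₀_iff (hdA : IsQuasiPeriodicDecomp (AddSubgroup.zmultiples k) A A₁ A₀)
    (ha₀ : a₀ ∈ A₀) {y : G} :
    y ∈ (((a₀ +ᵥ apFinset (0 : G) k (addOrderOf k)) \ A₀).image fun x => c₀ - x) ↔
      (c₀ - y) - a₀ ∈ AddSubgroup.zmultiples k ∧ c₀ - y ∉ A := by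
  rw [mem_image]
  constructor
  · rintro ⟨x, hx, rfl⟩
    rw [mem_sdiff, mem_vadd_finset] at hx
    obtain ⟨⟨z, hz, rfl⟩, hxA₀⟩ := hx
    rw [sub_sub_cancel, vadd_eq_add, add_sub_cancel_left]
    refine ⟨(mem_apFinset_zero_addOrderOf_iff k z).1 hz, fun hxA => hxA₀ ?_⟩
    exact hdA.mem_right_of_sub_mem hxA ha₀ (by
      rw [vadd_eq_add, add_sub_cancel_left]; exact (mem_apFinset_zero_addOrderOf_iff k z).1 hz)
  · rintro ⟨h1, h2⟩
    refine ⟨c₀ - y, mem_sdiff.2 ⟨mem_vadd_finset.2 ⟨c₀ - y - a₀,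
      (mem_apFinset_zero_addOrderOf_iff k _).2 h1, by rw [vadd_eq_add]; abel⟩,
      fun h => h2 (hdA.right_subset h)⟩, sub_sub_cancel c₀ y⟩

/-- Membership in `B₁`. [cite: Kemperman1960, Lemma 4.6; Thm 5.1] -/
private theorem mem_B₁_iff (hdA : IsQuasiPeriodicDecomp (AddSubgroup.zmultiples k) A A₁ A₀)
    (ha₀ : a₀ ∈ A₀) {y : G} :
    y ∈ ((A₁ ∪ (a₀ +ᵥ apFinset (0 : G) k (addOrderOf k)))ᶜ.image fun x => c₀ - x) ↔
      (c₀ - y) - a₀ ∉ AddSubgroup.zmultiples k ∧ c₀ - y ∉ A := by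
  rw [mem_image]
  constructor
  · rintro ⟨x, hx, rfl⟩
    rw [mem_compl, mem_union, not_or, mem_vadd_finset] at hx
    rw [sub_sub_cancel]
    refine ⟨fun h => hx.2 ⟨x - a₀, (mem_apFinset_zero_addOrderOf_iff k _).2 h, by
      rw [vadd_eq_add]; abel⟩, fun hxA => ?_⟩
    rw [← hdA.union_eq, mem_union] at hxA
    rcases hxA with h | h
    · exact hx.1 h
    · exact hx.2 ⟨x - a₀, (mem_apFinset_zero_addOrderOf_iff k _).2 (hdA.sub_mem x h a₀ ha₀), by
        rw [vadd_eq_add]; abel⟩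
  · rintro ⟨h1, h2⟩
    refine ⟨c₀ - y, ?_, sub_sub_cancel c₀ y⟩
    rw [mem_compl, mem_union, not_or, mem_vadd_finset]
    refine ⟨fun h => h2 (hdA.left_subset h), ?_⟩
    rintro ⟨z, hz, hzy⟩
    apply h1
    rw [← hzy, vadd_eq_add, add_sub_cancel_left]
    exact (mem_apFinset_zero_addOrderOf_iff k z).1 hz

/-- `B = c₀ − Ā` decomposes as `B₁ ∪ B₀` with quasi-period `⟨k⟩`. [cite: Kemperman1960, Thm 5.1] -/
private theorem decomp_B (hk : k ≠ 0)
    (hdA : IsQuasiPeriodicDecomp (AddSubgroup.zmultiples k) A A₁ A₀) (ha₀ : a₀ ∈ A₀)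
    (hB : ∀ y, y ∈ B ↔ c₀ - y ∉ A) :
    IsQuasiPeriodicDecomp (AddSubgroup.zmultiples k) B
      (((A₁ ∪ (a₀ +ᵥ apFinset (0 : G) k (addOrderOf k)))ᶜ.image fun x => c₀ - x))
      (((a₀ +ᵥ apFinset (0 : G) k (addOrderOf k)) \ A₀).image fun x => c₀ - x) where
  ne_bot := by rwa [Ne, AddSubgroup.zmultiples_eq_bot]
  disjoint := by
    rw [disjoint_left]
    intro y h1 h2
    exact ((mem_B₁_iff hdA ha₀).1 h1).1 ((mem_B₀_iff hdA ha₀).1 h2).1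
  union_eq := by
    ext y
    rw [mem_union, mem_B₁_iff hdA ha₀, mem_B₀_iff hdA ha₀, hB]
    tauto
  periodic := by
    have hKf : ∀ g, g ∈ apFinset (0 : G) k (addOrderOf k) ↔ g ∈ AddSubgroup.zmultiples k :=
      mem_apFinset_zero_addOrderOf_iff k
    exact ((hdA.periodic.union (isPeriodicWith_vadd_carrier hKf a₀)).compl).image_const_sub c₀
  sub_mem := by
    intro x hx y hy
    have h1 := ((mem_B₀_iff hdA ha₀).1 hx).1
    have h2 := ((mem_B₀_iff hdA ha₀).1 hy).1
    have e : x - y = (c₀ - y - a₀) - (c₀ - x - a₀) := by abel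
    rw [e]
    exact AddSubgroup.sub_mem _ h2 h1

/-- Condition (i) for the construction. [cite: Kemperman1960, Thm 5.1 (ii)] -/
private theorem quot_unique_B (hdA : IsQuasiPeriodicDecomp (AddSubgroup.zmultiples k) A A₁ A₀)
    (ha₀ : a₀ ∈ A₀) (hB : ∀ y, y ∈ B ↔ c₀ - y ∉ A) :
    ∀ a ∈ A, ∀ b ∈ B, ∀ a' ∈ A₀,
      ∀ b' ∈ (((a₀ +ᵥ apFinset (0 : G) k (addOrderOf k)) \ A₀).image fun x => c₀ - x),
      (a + b) - (a' + b') ∈ AddSubgroup.zmultiples k →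
        a - a' ∈ AddSubgroup.zmultiples k ∧ b - b' ∈ AddSubgroup.zmultiples k := by
  intro a ha b hb a' ha' b' hb' hq
  set K := AddSubgroup.zmultiples k
  obtain ⟨hb'1, -⟩ := (mem_B₀_iff hdA ha₀).1 hb'
  have hbA : c₀ - b ∉ A := (hB b).1 hb
  -- `a ∈ A₀`: otherwise `a ∈ A₁` and `c₀ − b ≡ a (mod K)` would lie in `A₁ ⊆ A`
  have haa' : a - a' ∈ K := by
    by_contra hnot
    have haA₁ : a ∈ A₁ := by
      rw [← hdA.union_eq, mem_union] at ha
      exact ha.resolve_right fun haA₀ => hnot (hdA.sub_mem a haA₀ a' ha')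
    -- `(c₀ - b) - a ∈ K`
    have hmod : (c₀ - b) - a ∈ K := by
      have e : (c₀ - b) - a = (c₀ - b' - a₀) + (a₀ - a') - ((a + b) - (a' + b')) := by abel
      rw [e]
      exact K.sub_mem (K.add_mem hb'1 (hdA.sub_mem a₀ ha₀ a' ha')) hq
    exact hbA (by
      have := hdA.periodic.add_mem hmod haA₁
      rw [sub_add_cancel] at this
      exact hdA.left_subset this)
  refine ⟨haa', ?_⟩
  have e' : b - b' = ((a + b) - (a' + b')) - (a - a') := by abel
  rw [e']
  exact K.sub_mem hq haa'

end QuasiProgression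

section Assembly

variable [Fintype G] {A B A₁ A₀ : Finset G} {c₀ k a₀ : G}

/-- `|φ_K(G ∖ {c₀})| = |φ_K(G)|` for a nontrivial subgroup `K`. [cite: Kemperman1960, Thm 5.1 (iv)] -/
private theorem cosetCount_univ_erase {K : AddSubgroup G} {k : G} (hkK : k ∈ K) (hk : k ≠ 0) (c₀ : G) :
    cosetCount K (univ.erase c₀) = cosetCount K (univ : Finset G) := by
  classical
  rw [cosetCount_eq_card_image, cosetCount_eq_card_image]
  congr 1
  refine Subset.antisymm (image_subset_image (erase_subset _ _)) fun q hq => ?_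
  obtain ⟨x, -, rfl⟩ := mem_image.1 hq
  by_cases hx : x = c₀
  · refine mem_image.2 ⟨x + k, mem_erase.2 ⟨?_, mem_univ _⟩, ?_⟩
    · rw [hx]; intro h
      exact hk (by simpa using h)
    · exact QuotientAddGroup.eq.2 (by rw [neg_add_rev, add_assoc, neg_add_cancel, add_zero]; exact K.neg_mem hkK)
  · exact mem_image.2 ⟨x, mem_erase.2 ⟨hx, mem_univ _⟩, rfl⟩

/-- Condition (ii) for the construction: `|φ_K(A + B)| = |φ_K(A)| + |φ_K(B)| − 1`.
[cite: Kemperman1960, Thm 5.1 (iv)] -/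
private theorem cosetCount_AB (hk : k ≠ 0)
    (hdA : IsQuasiPeriodicDecomp (AddSubgroup.zmultiples k) A A₁ A₀) (ha₀ : a₀ ∈ A₀)
    (hB : ∀ y, y ∈ B ↔ c₀ - y ∉ A) (hsum : A + B = univ.erase c₀)
    (hB₀ : ((((a₀ +ᵥ apFinset (0 : G) k (addOrderOf k)) \ A₀).image fun x => c₀ - x)).Nonempty) :
    cosetCount (AddSubgroup.zmultiples k) (A + B) + 1 =
      cosetCount (AddSubgroup.zmultiples k) A + cosetCount (AddSubgroup.zmultiples k) B := by
  set K := AddSubgroup.zmultiples k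
  set Kf := apFinset (0 : G) k (addOrderOf k)
  have hKf : ∀ g, g ∈ Kf ↔ g ∈ K := mem_apFinset_zero_addOrderOf_iff k
  set X := A₁ ∪ (a₀ +ᵥ Kf)
  have hXper : IsPeriodicWith K X := hdA.periodic.union (isPeriodicWith_vadd_carrier hKf a₀)
  have c1 : cosetCount K X = cosetCount K A₁ + 1 := by
    rw [cosetCount_union, cosetCount_eq_one_of_sub_mem ⟨a₀, mem_vadd_finset.2 ⟨0, (hKf 0).2 K.zero_mem,
      by rw [vadd_eq_add, add_zero]⟩⟩]
    · intro x hx y hy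
      obtain ⟨u, hu, rfl⟩ := mem_vadd_finset.1 hx
      obtain ⟨v, hv, rfl⟩ := mem_vadd_finset.1 hy
      rw [vadd_eq_add, vadd_eq_add, add_sub_add_left_eq_sub]
      exact K.sub_mem ((hKf u).1 hu) ((hKf v).1 hv)
    · intro x hx y hy hxy
      obtain ⟨v, hv, rfl⟩ := mem_vadd_finset.1 hy
      refine hdA.sub_notMem hx ha₀ ?_
      have e : x - a₀ = x - (a₀ +ᵥ v) + v := by rw [vadd_eq_add]; abel
      rw [e]; exact K.add_mem hxy ((hKf v).1 hv)
  have c2 : cosetCount K (univ : Finset G) = cosetCount K X + cosetCount K Xᶜ := by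
    rw [← cosetCount_union, union_compl]
    intro x hx y hy hxy
    rw [mem_compl] at hy
    refine hy ?_
    have := hXper.add_mem (K.neg_mem hxy) hx
    rwa [neg_sub, sub_add_cancel] at this
  have c3 : cosetCount K A = cosetCount K A₁ + 1 := hdA.cosetCount_eq ⟨a₀, ha₀⟩
  have c4 := (decomp_B hk hdA ha₀ hB).cosetCount_eq hB₀
  have c5 : cosetCount K ((X)ᶜ.image fun x => c₀ - x) = cosetCount K Xᶜ := cosetCount_image_const_sub _ _ _
  have c6 : cosetCount K (A + B) = cosetCount K (univ : Finset G) := by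
    rw [hsum]; exact cosetCount_univ_erase (AddSubgroup.mem_zmultiples k) hk c₀
  rw [c4, c5, c3, c6, c2, c1]
  ring

/-- `B₀ ≠ ∅`: `A₀` is not the whole coset, since `A` is not `k`-invariant.
[cite: Kemperman1960, Thm 5.1] -/
private theorem B₀_nonempty (hQ : IsQuasiProgression k A)
    (hdA : IsQuasiPeriodicDecomp (AddSubgroup.zmultiples k) A A₁ A₀) (ha₀ : a₀ ∈ A₀) :
    ((((a₀ +ᵥ apFinset (0 : G) k (addOrderOf k)) \ A₀).image fun x => c₀ - x)).Nonempty := by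
  rw [image_nonempty, nonempty_iff_ne_empty, Ne, sdiff_eq_empty_iff_subset]
  intro hsub
  have hKf : ∀ g, g ∈ apFinset (0 : G) k (addOrderOf k) ↔ g ∈ AddSubgroup.zmultiples k :=
    mem_apFinset_zero_addOrderOf_iff k
  have hA₀eq : A₀ = a₀ +ᵥ apFinset (0 : G) k (addOrderOf k) :=
    (subset_vadd_carrier_of_sub_mem hKf (fun x hx => hdA.sub_mem x hx a₀ ha₀)).antisymm hsub
  have hAper : IsPeriodicWith (AddSubgroup.zmultiples k) A := by
    rw [← hdA.union_eq, hA₀eq]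
    exact hdA.periodic.union (isPeriodicWith_vadd_carrier hKf a₀)
  have h0 : componentCount k A = 0 :=
    componentCount_eq_zero_iff.2 (hAper k (AddSubgroup.mem_zmultiples k))
  rw [hQ] at h0
  exact one_ne_zero h0

/-- Condition (iv) for the construction: `(A₀, B₀)` is of type (I) or (II) — both are progressions
with difference `k` inside one `⟨k⟩`-coset, of total size the order of `k`.
[cite: Kemperman1960, Lemma 4.6; Thm 5.1 (i)] -/
private theorem elementary_A₀B₀ (hdA : IsQuasiPeriodicDecomp (AddSubgroup.zmultiples k) A A₁ A₀)
    (ha₀ : a₀ ∈ A₀) (hAP : IsAP A₀ k)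
    (hB₀ : ((((a₀ +ᵥ apFinset (0 : G) k (addOrderOf k)) \ A₀).image fun x => c₀ - x)).Nonempty) :
    IsElementaryPair A₀ (((a₀ +ᵥ apFinset (0 : G) k (addOrderOf k)) \ A₀).image fun x => c₀ - x) := by
  set Kf := apFinset (0 : G) k (addOrderOf k)
  set n := addOrderOf k
  have hKf : ∀ g, g ∈ Kf ↔ g ∈ AddSubgroup.zmultiples k := mem_apFinset_zero_addOrderOf_iff k
  obtain ⟨s, hs⟩ := hAP
  set ℓ := #A₀
  have hℓ : 1 ≤ ℓ := card_pos.2 ⟨a₀, ha₀⟩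
  have hsA₀ : s ∈ A₀ := by
    rw [hs, mem_apFinset]; exact ⟨0, by omega, by rw [zero_nsmul, add_zero]⟩
  -- the coset of `a₀` is the coset of `s`
  have hcos : a₀ +ᵥ Kf = s +ᵥ Kf := by
    have hmem : s - a₀ ∈ AddSubgroup.zmultiples k := hdA.sub_mem s hsA₀ a₀ ha₀
    calc a₀ +ᵥ Kf = a₀ +ᵥ ((s - a₀) +ᵥ Kf) := by rw [vadd_finset_eq_of_forall_mem_iff hKf hmem]
      _ = s +ᵥ Kf := by rw [vadd_vadd, add_sub_cancel]
  have hKcard : #Kf = n := Isoperimetric.card_apFinset_of_le_addOrderOf _ _ le_rfl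
  have hℓn : ℓ ≤ n := by
    have h1 : A₀ ⊆ a₀ +ᵥ Kf := subset_vadd_carrier_of_sub_mem hKf fun x hx => hdA.sub_mem x hx a₀ ha₀
    have := card_le_card h1
    rwa [card_vadd_finset, hKcard] at this
  obtain ⟨hDeq, hDcard⟩ := coset_sdiff_apFinset_eq s k hℓn
  rw [← hs, ← hcos] at hDeq hDcard
  set D := (a₀ +ᵥ Kf) \ A₀
  have hB₀card : #(D.image fun x => c₀ - x) = n - ℓ := by
    rw [card_image_of_injective _ (fun x y (h : c₀ - x = c₀ - y) => sub_right_injective h), hDcard]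
  have hDap : IsAP D k := ⟨s + ℓ • k, by rw [hDcard]; exact hDeq⟩
  have hB₀ap : IsAP (D.image fun x => c₀ - x) k := by
    rw [image_const_sub_eq_vadd_neg]; exact hDap.neg.vadd c₀
  have hA₀ne : A₀.Nonempty := ⟨a₀, ha₀⟩
  by_cases h1 : ℓ = 1 ∨ n - ℓ = 1
  · left
    refine ⟨hA₀ne, hB₀, ?_⟩
    rcases h1 with h1 | h1
    · exact Or.inl h1
    · exact Or.inr (by rw [hB₀card, h1])
  · right; left
    have hpos : 0 < n - ℓ := by rw [← hB₀card]; exact card_pos.2 hB₀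
    refine ⟨by omega, by rw [hB₀card]; omega, k, ⟨s, hs⟩, hB₀ap, Or.inr ?_⟩
    rw [hB₀card]; omega

end Assembly

/-- `(s + A) + (t + B) = (s + t) + (A + B)`. [cite: Kemperman1960, §5] -/
private theorem vadd_add_vadd_eq' (A B : Finset G) (s t : G) :
    (s +ᵥ A) + (t +ᵥ B) = (s + t) +ᵥ (A + B) := by
  rw [vadd_add_assoc, add_comm A (t +ᵥ B), vadd_add_assoc, vadd_vadd, add_comm B A]

section Main

variable [Fintype G]

/-- **Critical pairs whose sum is the group with one element deleted are Kemperman pairs**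
(Kemperman 1960, proof of Lemma 5.2, case (ii) «`A + B` is obtained from the coset `g + H` … by
deleting exactly one element `c₀`», via Lemma 4.2 and Lemma 4.6 (ii): «Then either both `A` and `B`
are in arithmetic progression of difference `d = c₁ − c₀` or `P₁(A, B)` is non-empty»), in the
quasi-periodic language: if `A, B ≠ ∅`, `A + B = G ∖ {c₀}` and `|A + B| ≤ |A| + |B| − 1` then `(A, B)`
admits a decomposition satisfying Kemperman's (i)–(iv) (`IsKempermanDecompI`).  PROOF (ours, by the
tree's quasi-progressions instead of Kemperman's `P(A, B)`): by Lemma 4.2 `B = c₀ − Ā`; if no element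
of `A + B` has a unique expression the pair is of type (IV) (`isElementaryIV_of_add_eq_erase`), a
Kemperman pair with quasi-period `G`; if `c = a + b` has a unique expression then
`1 = r_{A,B}(c) = c_k(A)` for `k = c₀ − c ≠ 0` (`addConvolution_eq_componentCount`), so `A` is a
quasi-progression with difference `k` and `A = A₁ ⊔ A₀` with `A₁` `⟨k⟩`-periodic and `A₀ ≠ ∅` a
progression with difference `k` in one coset `C₀` (`IsQuasiProgression.exists_isQuasiPeriodicDecomp`);
then `B = (c₀ − \overline{A₁ ∪ C₀}) ⊔ (c₀ − (C₀ ∖ A₀))`, `(A₀, c₀ − (C₀ ∖ A₀))` is a pair of progressions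
with difference `k` of total size `ord k` — type (I) or (II) —, `φ(A₀) + φ(B₀) = φ(c₀)` has a unique
expression in `φ(A) + φ(B)`, and `|φ(A + B)| = [G : ⟨k⟩] = |φ(A)| + |φ(B)| − 1`.  (Grynkiewicz's
condition (iii) is NOT asserted: for `|A| = 1` the quasi-period must be chosen differently.)
[cite: Kemperman1960, Lemma 5.2 (proof, case (ii)); Lemma 4.6] -/
theorem exists_isKempermanDecompI_of_add_eq_univ_erase {A B : Finset G} {c₀ : G} (hA : A.Nonempty)
    (hB : B.Nonempty) (hsum : A + B = univ.erase c₀) (hcrit : #(A + B) + 1 ≤ #A + #B) :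
    ∃ (H : AddSubgroup G) (A₁ A₀ B₁ B₀ : Finset G), IsKempermanDecompI H A B A₁ A₀ B₁ B₀ := by
  obtain ⟨a, ha⟩ := id hA
  have hHf : ∀ g, g ∈ (univ : Finset G) ↔ g ∈ (⊤ : AddSubgroup G) := fun g =>
    iff_of_true (mem_univ g) (AddSubgroup.mem_top g)
  have hsum' : A + B = (c₀ +ᵥ (univ : Finset G)).erase c₀ := by rwa [vadd_finset_univ]
  obtain ⟨-, -, hBiff, -⟩ := kemperman_lemma42 hHf ha hB hsum' hcrit
  have hB' : ∀ y, y ∈ B ↔ c₀ - y ∉ A := fun y =>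
    (hBiff y).trans (and_iff_right (AddSubgroup.mem_top _))
  have hG : (⊤ : AddSubgroup G) ≠ ⊥ := by
    intro h
    obtain ⟨x, hx⟩ := (hA.add hB)
    rw [hsum, mem_erase] at hx
    have hx0 : x ∈ (⊤ : AddSubgroup G) := AddSubgroup.mem_top x
    have hc0 : c₀ ∈ (⊤ : AddSubgroup G) := AddSubgroup.mem_top c₀
    rw [h, AddSubgroup.mem_bot] at hx0 hc0
    exact hx.1 (by rw [hx0, hc0])
  by_cases hone : ∃ c, A.addConvolution B c = 1
  · obtain ⟨c, hc⟩ := hone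
    have hQ : IsQuasiProgression (c₀ - c) A := by
      rw [IsQuasiProgression, ← addConvolution_eq_componentCount hB' c]; exact hc
    have hk : c₀ - c ≠ 0 := hQ.ne_zero
    obtain ⟨A₁, A₀, hdA, hAP, ⟨a₀, ha₀⟩⟩ := hQ.exists_isQuasiPeriodicDecomp
    have hB₀ := B₀_nonempty (c₀ := c₀) hQ hdA ha₀
    exact ⟨_, A₁, A₀, _, _,
      { decomp_left := hdA
        decomp_right := decomp_B hk hdA ha₀ hB'
        left_nonempty := ⟨a₀, ha₀⟩
        right_nonempty := hB₀
        quot_unique := quot_unique_B hdA ha₀ hB'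
        cosetCount_add := cosetCount_AB hk hdA ha₀ hB' hsum hB₀
        elementary := elementary_A₀B₀ hdA ha₀ hAP hB₀ }⟩
  · have hone' : ∀ x, A.addConvolution B x ≠ 1 := fun x hx => hone ⟨x, hx⟩
    have hIV := isElementaryIV_of_add_eq_erase hHf hA hB hsum' hcrit hone'
    have hE : IsElementaryPair A B := Or.inr (Or.inr (Or.inr hIV))
    exact ⟨⊤, ∅, A, ∅, B, hE.isKempermanDecompI_top hG⟩

omit [Fintype G] in
/-- Kemperman-form decompositions are translation invariant (the sum `(c₀ + H) ∖ {c₀}` of Kemperman's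
case (ii) — `A ⊆ a + H`, `B ⊆ b + H` by Lemma 4.2 — reduces to the group case inside `H` by
translation; `-- TODO(general form)`: that reduction is left to the assembly of Theorem 5.1).
[cite: Kemperman1960, Lemma 5.2 (proof, case (ii))] -/
theorem IsKempermanDecompI.vadd {H : AddSubgroup G} {A B A₁ A₀ B₁ B₀ : Finset G}
    (h : IsKempermanDecompI H A B A₁ A₀ B₁ B₀) (s t : G) :
    IsKempermanDecompI H (s +ᵥ A) (t +ᵥ B) (s +ᵥ A₁) (s +ᵥ A₀) (t +ᵥ B₁) (t +ᵥ B₀) := by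
  have e := (vadd_add_vadd_eq' A B s t)
  refine ⟨h.decomp_left.vadd s, h.decomp_right.vadd t, h.left_nonempty.vadd_finset,
    h.right_nonempty.vadd_finset, ?_, ?_, h.elementary.vadd s t⟩
  · intro a ha b hb a₀ ha₀ b₀ hb₀ hq
    obtain ⟨a', ha', rfl⟩ := mem_vadd_finset.1 ha
    obtain ⟨b', hb', rfl⟩ := mem_vadd_finset.1 hb
    obtain ⟨a₀', ha₀', rfl⟩ := mem_vadd_finset.1 ha₀
    obtain ⟨b₀', hb₀', rfl⟩ := mem_vadd_finset.1 hb₀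
    have e' : (s +ᵥ a') + (t +ᵥ b') - ((s +ᵥ a₀') + (t +ᵥ b₀')) = a' + b' - (a₀' + b₀') := by
      simp only [vadd_eq_add]; abel
    rw [e'] at hq
    have := h.quot_unique a' ha' b' hb' a₀' ha₀' b₀' hb₀' hq
    simp only [vadd_eq_add, add_sub_add_left_eq_sub]
    exact this
  · rw [e, cosetCount_vadd, cosetCount_vadd, cosetCount_vadd, h.cosetCount_add]

end Main

end Literature.Combinatorics.Additive
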